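import Mathlib
import Summits.QuantumAdvantage.QuantumAdvantage.Theorems.LinnikCubicClassGroupsPureCubicClassNumberHardDescent
import Summits.QuantumAdvantage.QuantumAdvantage.Theorems.LinnikCubicClassGroupsPureCubicClassNumberHardHonda88Kummer
import Summits.QuantumAdvantage.QuantumAdvantage.Theorems.LinnikCubicClassGroupsPureCubicClassNumberHardHondaTwoInertSetup
import Summits.QuantumAdvantage.QuantumAdvantage.Theorems.LinnikCubicClassGroupsPureCubicClassNumberHardHonda25
import Summits.QuantumAdvantage.QuantumAdvantage.Theorems.LinnikCubicClassGroupsPureCubicClassNumberHardStubRamificationCensus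
import Literature.NumberTheory.NumberFields.PureCubicClassNumberModThree
import HarnessLib

/-!
# Honda's two-prime criterion, PROVED: `Honda1971_three_dvd_classNumber_twoPrimes_holds`

Route `LinnikCubicClassGroups` (rank-0 hypothesis-type target `PureCubicClassNumberHard`,
stmt-QuantumAdvantage-11826).  The named Literature fact
`Literature.NumberTheory.NumberFields.Honda1971_three_dvd_classNumber_twoPrimes`
([AouissiMayerIsmailiTalbiAzizi2020, Thm. 2.3]; Honda 1971, Theorem): for distinct primes `p, q`
with `pq ≡ ±1 (mod 9)` and every cubic number field `K ∋ ∛(pq)`,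
`3 ∣ h(K) ⟺ ¬(p ≡ 2,5 (mod 9) ∧ q ≡ 2,5 (mod 9))` — is now a theorem of the tree:

* `three_dvd_classNumber_of_primes_mod_nine_eight` — **the last case `p ≡ q ≡ 8 (mod 9)`:
  `3 ∣ h(K)`**, by `3 ∣ h(K(ζ₃))` (`…Honda88Kummer.lean`, the unramified Kummer extension
  `K(ζ₃, ∛p)`) and the Hasse-free descent (`…Descent.lean`);
* `Honda1971_three_dvd_classNumber_twoPrimes_holds` — the assembly with `honda25` (`{p, q} ≡
  {2, 5} (mod 9)`: `3 ∤ h`) and the genus case `p ≡ 1` or `q ≡ 1 (mod 3)`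
  (`Honda1971.three_dvd_classNumber_of_mod_three_eq_one`).

Consequence for the route: the transfer `pureCubicClassNumberHard_of_honda_of_phiHiding3`
(`…HondaLeakTransfer.lean`) no longer has a number-theoretic leaf; only the Φ-hiding hypothesis
remains (as already achieved on the promise family by `…Honda25.lean`).

HONEST FRAMING (block-2b rule): kernel-checked classical algebraic number theory (Honda 1971), an
independent certification, NOT summit progress; the crux `PureCubicClassNumberHard` is
hypothesis-type and untouched.

## References
* T. Honda, *Pure cubic fields whose class numbers are multiples of three*, J. Number Theory 3
  (1971) 7–12, Theorem. [Honda1971]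
* S. Aouissi, D. C. Mayer, M. C. Ismaili, M. Talbi, A. Azizi, *3-rank of ambiguous class groups of
  cubic Kummer extensions*, Period. Math. Hungar. 81 (2020), Thm. 2.3. [AouissiMayerIsmailiTalbiAzizi2020]
-/

set_option linter.dupNamespace false

noncomputable section

open NumberField Polynomial IsDedekindDomain

open scoped Pointwise NumberField nonZeroDivisors IntermediateField

namespace Summit.QuantumAdvantage.QuantumAdvantage.Theorems.LinnikCubicClassGroups

open Literature.NumberTheory.NumberFields

/-! ### Honda's criterion, case `p ≡ q ≡ 8 (mod 9)` -/

/-- **Honda 1971, the case `m = pq` with `p ≡ q ≡ 8 (mod 9)`: `3 ∣ h(K)` for every cubic number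
field `K ∋ ∛(pq)`** — the last case of the two-prime criterion, proved WITHOUT Hasse's norm
theorem and without the Brauer class number relation: `L = K(ζ₃)` has the unramified cyclic cubic
extension `L(∛p)` (`three_dvd_classNumber_of_cubeRoot_unramified`), so `3 ∣ h(L)`, and the
descent `three_dvd_classNumber_descent` (`τστ = σ²`, `N_{L/K}` on ideals, Chevalley's step per
class) gives `3 ∣ h(K)`. [cite: Honda1971, Theorem] [cite: AouissiMayerIsmailiTalbiAzizi2020, Thm. 2.3] -/
theorem three_dvd_classNumber_of_primes_mod_nine_eight (p q : ℕ) (hp : p.Prime) (hq : q.Prime)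
    (hpq : p ≠ q) (hp9 : p % 9 = 8) (hq9 : q % 9 = 8)
    (K : Type) [Field K] [NumberField K] (hK : Module.finrank ℚ K = 3)
    (hα : ∃ α : K, α ^ 3 = ((p * q : ℕ) : K)) : 3 ∣ classNumber K := by
  classical
  obtain ⟨α, hα⟩ := hα
  have hp3 : p % 3 = 2 := by omega
  have hq3 : q % 3 = 2 := by omega
  have hq3' : q ≠ 3 := by omega
  have hp3' : p ≠ 3 := by omega
  have h91 : (p * q) % 9 = 1 := by
    rw [Nat.mul_mod, hp9, hq9]
  let L := CyclotomicField 3 K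
  obtain ⟨hKL, hL6, hGal, F, hgal, hFL, hF2, ⟨σ, hσ⟩, hPID, -, ⟨θ, hθ, hθdeg⟩, ζ, hζ3, hζ1, hζeq,
    hunits, P₁, P₂, hP₁, hP₂, h12, hpP₁, hqP₂, hspan₁, hspan₂, he₁, he₂⟩ :=
    fieldSetup_twoPrimes hp hq hpq hp3 hq3 K hK hα L
  haveI := hgal
  haveI := hGal
  haveI := hP₁
  haveI := hP₂
  haveI : IsGalois K L := IsCyclotomicExtension.isGalois {3} K L
  -- `3 ∣ h(L)`
  have hζL : (((ζ : 𝓞 F) : F) : L) ^ 2 + (((ζ : 𝓞 F) : F) : L) + 1 = 0 := by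
    have h := congrArg (fun w : 𝓞 F => ((w : F) : L)) hζeq
    simpa using h
  have hirr : ∀ b : L, b ^ 3 ≠ (p : L) :=
    pow_three_ne_natCast_of_ramified F hF2 hFL hp hq hpq hq3' hqP₂ he₂
  have h3L : 3 ∣ classNumber L :=
    three_dvd_classNumber_of_cubeRoot_unramified L hζL hp hq hpq hp9 hθ hirr
  -- the data of the descent
  set αL : L := algebraMap K L α with hαLdef
  have hαL3 : αL ^ 3 = ((p * q : ℕ) : L) := by
    rw [hαLdef, ← map_pow, hα, map_natCast]
  have hθσ : σ αL ≠ αL := by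
    intro hfix
    -- `αL ∈ F`, but `[ℚ(αL) : ℚ] = 3 > 2 = [F : ℚ]`
    obtain ⟨f, hf⟩ : ∃ f : F, algebraMap F L f = αL := by
      refine (IsGalois.mem_range_algebraMap_iff_fixed (F := F) αL).mpr fun g => ?_
      rcases algEquiv_eq_of_forall_mem_zpowers F hσ hFL g with rfl | rfl | rfl
      · rfl
      · exact hfix
      · rw [AlgEquiv.mul_apply, hfix, hfix]
    have hmin : minpoly ℚ αL = X ^ 3 - C ((p * q : ℕ) : ℚ) := Honda1971.minpoly_eq hp hq hpq hαL3
    have hmin' : minpoly ℚ f = minpoly ℚ αL := by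
      rw [← hf]
      exact (minpoly.algebraMap_eq (algebraMap F L).injective f).symm
    have hle : (minpoly ℚ f).natDegree ≤ Module.finrank ℚ F := minpoly.natDegree_le f
    rw [hmin', hmin, natDegree_X_pow_sub_C, hF2] at hle
    omega
  have ht₁ : Ideal.span {algebraMap (𝓞 F) (𝓞 L) (p : 𝓞 F)} = P₁ ^ 3 := by
    rw [map_natCast, hspan₁]
  have ht₂ : Ideal.span {algebraMap (𝓞 F) (𝓞 L) (q : 𝓞 F)} = P₂ ^ 3 := by
    rw [map_natCast, hspan₂]
  -- the ramified primes of `L/F` are `P₁`, `P₂`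
  have huniq : ∀ {r : ℕ} {P Q : Ideal (𝓞 L)}, P.IsMaximal → Q.IsMaximal →
      Ideal.span {(r : 𝓞 L)} = P ^ 3 → (r : 𝓞 L) ∈ Q → Q = P := by
    intro r P Q hP hQ hspan hrQ
    have hle : P ^ 3 ≤ Q := by
      rw [← hspan, Ideal.span_singleton_le_iff_mem]
      exact hrQ
    exact (hP.eq_of_le hQ.ne_top (hQ.isPrime.le_of_pow_le hle)).symm
  have hram : ∀ Q : Ideal (𝓞 L), Q.IsMaximal → Q.ramificationIdx (𝓞 F) ≠ 1 → Q = P₁ ∨ Q = P₂ := by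
    intro Q hQ hne
    rcases stub_ramificationCensus p q hp hq hp3' hq3' hpq h91 L F hL6 hFL
        ⟨((ζ : 𝓞 F) : F), hζ3, hζ1⟩ ⟨θ, hθ⟩ Q hQ hne with h | h
    · exact Or.inl (huniq hP₁ hQ hspan₁ h)
    · exact Or.inr (huniq hP₂ hQ hspan₂ h)
  -- the ideals `𝔭ᵢ = (pᵢ, ∛(pq))` of `K`
  obtain ⟨θK, hθK⟩ := Honda1971.exists_ringOfIntegers_coe_eq_of_pow_three
    (m := p * q) (K := K) (by exact_mod_cast hα)
  have hθK3 : θK ^ 3 = (p : 𝓞 K) * (q : 𝓞 K) := by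
    apply RingOfIntegers.coe_injective
    have h := hα
    rw [← hθK] at h
    push_cast at h ⊢
    exact_mod_cast h
  have hbez : ∀ {r s : ℕ}, r.Prime → s.Prime → r ≠ s →
      ∃ a b : 𝓞 K, a * (r : 𝓞 K) ^ 2 + b * (s : 𝓞 K) = 1 := by
    intro r s hr hs hrs
    have hcop : IsCoprime ((r : ℤ) ^ 2) (s : ℤ) :=
      (Nat.isCoprime_iff_coprime.mpr ((Nat.coprime_primes hr hs).mpr hrs)).pow_left
    obtain ⟨a, b, hab⟩ := hcop
    exact ⟨a, b, by exact_mod_cast hab⟩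
  obtain ⟨a₁, b₁, hab₁⟩ := hbez hp hq hpq
  obtain ⟨a₂, b₂, hab₂⟩ := hbez hq hp hpq.symm
  set 𝔭₁ : Ideal (𝓞 K) := Ideal.span {(p : 𝓞 K), θK} with h𝔭₁
  set 𝔭₂ : Ideal (𝓞 K) := Ideal.span {(q : 𝓞 K), θK} with h𝔭₂
  have h𝔭₁3 : 𝔭₁ ^ 3 = Ideal.span {(p : 𝓞 K)} :=
    Honda1971.span_pair_pow_three_eq_span hθK3 hab₁
  have h𝔭₂3 : 𝔭₂ ^ 3 = Ideal.span {(q : 𝓞 K)} :=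
    Honda1971.span_pair_pow_three_eq_span (by rw [hθK3, mul_comm]) hab₂
  have hmap₁ : 𝔭₁.map (algebraMap (𝓞 K) (𝓞 L)) = P₁ := by
    refine eq_pow_of_pow_three_eq hP₁ (Ideal.IsMaximal.ne_bot_of_isIntegral_int P₁) (n := 1) ?_
      |>.trans (pow_one _)
    rw [← Ideal.map_pow, h𝔭₁3, Ideal.map_span, Set.image_singleton, map_natCast, hspan₁, mul_one]
  have hmap₂ : 𝔭₂.map (algebraMap (𝓞 K) (𝓞 L)) = P₂ := by
    refine eq_pow_of_pow_three_eq hP₂ (Ideal.IsMaximal.ne_bot_of_isIntegral_int P₂) (n := 1) ?_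
      |>.trans (pow_one _)
    rw [← Ideal.map_pow, h𝔭₂3, Ideal.map_span, Set.image_singleton, map_natCast, hspan₂, mul_one]
  have hpr₁ : (𝔭₁ ^ 3).IsPrincipal := ⟨⟨(p : 𝓞 K), by rw [h𝔭₁3, Ideal.submodule_span_eq]⟩⟩
  have hpr₂ : (𝔭₂ ^ 3).IsPrincipal := ⟨⟨(q : 𝓞 K), by rw [h𝔭₂3, Ideal.submodule_span_eq]⟩⟩
  have hm : p * q ≠ 0 := Nat.mul_ne_zero hp.ne_zero hq.ne_zero
  exact three_dvd_classNumber_descent K hK L hKL F hFL hF2 σ hσ hPID ζ hζeq hunits hm hα hθσ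
    hP₁ hP₂ ht₁ ht₂ hram hmap₁ hpr₁ hmap₂ hpr₂ h3L

/-- **Honda's two-prime criterion holds** (the named Literature fact
`Honda1971_three_dvd_classNumber_twoPrimes`, [AouissiMayerIsmailiTalbiAzizi2020, Thm. 2.3]):
for distinct primes `p, q` with `pq ≡ ±1 (mod 9)` and every cubic `K ∋ ∛(pq)`,
`3 ∣ h(K) ⟺ ¬(p ≡ 2,5 ∧ q ≡ 2,5 (mod 9))`.  Assembled from `honda25` (`p ≡ 2`, `q ≡ 5`:
`3 ∤ h`), the genus case `Honda1971.three_dvd_classNumber_of_mod_three_eq_one` (`p ≡ 1` or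
`q ≡ 1 (mod 3)`), and `three_dvd_classNumber_of_primes_mod_nine_eight` (`p ≡ q ≡ 8 (mod 9)`).
[cite: Honda1971, Theorem] [cite: AouissiMayerIsmailiTalbiAzizi2020, Thm. 2.3] -/
theorem Honda1971_three_dvd_classNumber_twoPrimes_holds :
    Literature.NumberTheory.NumberFields.Honda1971_three_dvd_classNumber_twoPrimes := by
  intro p q hp hq hpq h9 K _ _ hK hα
  obtain ⟨α, hα⟩ := hα
  constructor
  · rintro h3 ⟨hp25, hq25⟩
    have hmod : (p * q) % 9 = (p % 9) * (q % 9) % 9 := Nat.mul_mod p q 9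
    rcases hp25 with hp9 | hp9 <;> rcases hq25 with hq9 | hq9 <;> rw [hp9, hq9] at hmod <;>
      norm_num at hmod
    · omega
    · exact honda25 p q hp hq hp9 hq9 K hK ⟨α, hα⟩ h3
    · exact honda25 q p hq hp hq9 hp9 K hK ⟨α, by rw [hα, mul_comm]⟩ h3
    · omega
  · intro hnot
    rcases (Honda1971.not_twoFive_iff h9).mp hnot with h1 | h1 | ⟨hp8, hq8⟩
    · exact Honda1971.three_dvd_classNumber_of_mod_three_eq_one hp hq hpq (Or.inl h1) K hK hα
    · exact Honda1971.three_dvd_classNumber_of_mod_three_eq_one hp hq hpq (Or.inr h1) K hK hα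
    · exact three_dvd_classNumber_of_primes_mod_nine_eight p q hp hq hpq hp8 hq8 K hK ⟨α, hα⟩

end Summit.QuantumAdvantage.QuantumAdvantage.Theorems.LinnikCubicClassGroups

end
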